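import Mathlib
import Summits.HodgeConjecture.HodgeConjecture.Theorems.HodgeLocusCensusModelNonJumpC1

/-!
# Hodge-locus census — THEOREM K-MODEL, `c′ = 1`, for EVERY `k′ ≥ 3` and EVERY `d ≥ 5`: the model member is a NON-jump member
(def-free, computable helper of `stmt-HodgeConjecture-16267`; pub-hlocus, seat ivhs-2 = ENGINE B, gen 31; record `pub-hlocus-ivhs-2/ENGINEB-g31.md`
§11 THEOREM K-MODEL / §16; companion of `HodgeLocusCensusModelNonJumpC1.lean` (finite tables and `k′ = 3`), whose `basisL`, `suppMulL`, `sdeg` it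
cross-checks against.)

Setting as in the companion: cell `(2k′, d, k′-1)`, plane algebra `B = K[x_1..x_{k′}]/(x_i^{d-1})`, `δ = Σ_i x_i^{d-2}`,
`ρ = rank(×δ : B_{s-d} → B_{t-d})`, `s - d = k′(d-2) - d`, `t - d = k′(d-2) - 2`.  Exponent vectors are lists; `colR d m` lists, for each ZERO entry of
`m`, the vector with that entry raised to `d-2` — these are exactly the surviving products `x_i^{d-2}·x^m` (coefficient 1), i.e. the column of `x^m`
(`colR_eq_suppMulL_table` re-checks `colR = suppMulL` of the companion file on all source monomials, `k′ = 2,3,4`, `d = 5..8`, by `decide`).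

KERNEL-CHECKED HERE, with `k′` AND `d` SYMBOLIC (list induction + `omega`): `colR_pos` (no zero exponent ⇒ zero column); `colR_one_zero` (one zero
exponent, the others `≥ 1` ⇒ the unit column); `sum_le_of_zero_mem`; `source_others_pos` (`d ≥ 5`: a source monomial — entries `≤ d-2`, degree
`k′(d-2) - d` — with a zero exponent has all other exponents `≥ 1`); `target_has_top` (`k′ ≥ 3`: a target monomial — degree `k′(d-2) - 2` — has an exponent
`= d-2`); `covered_all` (every target monomial `v` is the unit column `[v]` of a source monomial); `column_unit_or_zero` (every column is a unit vector or
zero).  CONSEQUENCE (paper step: a 0/1 matrix whose nonzero columns are unit vectors covering every row has full row rank): for EVERY `k′ ≥ 3` and EVERY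
`d ≥ 5`, `ρ(F_{d;1,k′}) = dim B_{t-d} = H_B(t-d)`, hence `ρ = H_min` (as `ρ ≤ H_min ≤ H_B(t-d)`): the model member of `(2k′, d, k′-1)` is a NON-jump member —
THEOREM K-MODEL's `c′ = 1` statement off the exceptional family `k′ = 2` (anchor `ModelJumpFamily`) for all parameters at once, no finite table.
(`d = 3, 4` are the separate cases (3), (1)/(2) of the record's §11a and are not treated here.)

certified instances and evidence bearing on the general Hodge conjecture; no claim.
-/

set_option maxRecDepth 200000
set_option maxHeartbeats 8000000

namespace Summit.HodgeConjecture.HodgeConjecture.HodgeLocus.Census.ModelNonJumpC1All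

open Summit.HodgeConjecture.HodgeConjecture.HodgeLocus.Census.ModelNonJumpC1 (basisL suppMulL sdeg)

/-- column of `x^m` under `×δ`, `δ = Σ_i x_i^{d-2}`, in `B = K[x_1..x_k]/(x_i^{d-1})`: for each zero exponent of `m`, the exponent
vector with that entry raised to `d-2` (a product `x_i^{d-2}x^m` survives iff `m_i + (d-2) ≤ d-2` iff `m_i = 0`); every listed monomial has coefficient 1. -/
def colR (d : ℕ) : List ℕ → List (List ℕ)
  | [] => []
  | x :: m => (if x = 0 then [(d - 2) :: m] else []) ++ (colR d m).map (List.cons x)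

/-- no zero exponent ⇒ zero column -/
theorem colR_pos (d : ℕ) : ∀ m : List ℕ, (∀ x ∈ m, 1 ≤ x) → colR d m = []
  | [], _ => rfl
  | x :: m, h => by
      have hx : x ≠ 0 := by have := h x (by simp); omega
      have hm : ∀ y ∈ m, 1 ≤ y := fun y hy => h y (by simp [hy])
      simp [colR, hx, colR_pos d m hm]

/-- exactly one zero exponent ⇒ the unit column raising it to `d-2` -/
theorem colR_one_zero (d : ℕ) : ∀ as bs : List ℕ, (∀ x ∈ as, 1 ≤ x) → (∀ x ∈ bs, 1 ≤ x) →
    colR d (as ++ 0 :: bs) = [as ++ (d - 2) :: bs]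
  | [], bs, _, hb => by simp [colR, colR_pos d bs hb]
  | a :: as, bs, ha, hb => by
      have ha0 : a ≠ 0 := by have := ha a (by simp); omega
      have has : ∀ y ∈ as, 1 ≤ y := fun y hy => ha y (by simp [hy])
      simp [colR, ha0, colR_one_zero d as bs has hb]

/-- a list with entries `≤ M` containing a `0` has sum `≤ (length - 1)·M` -/
theorem sum_le_of_zero_mem (M : ℕ) (l : List ℕ) (hle : ∀ x ∈ l, x ≤ M) (h0 : 0 ∈ l) :
    l.sum + M ≤ l.length * M := by
  obtain ⟨s, t, rfl⟩ := List.append_of_mem h0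
  have hs : s.sum ≤ s.length * M := by
    have := List.sum_le_card_nsmul s M (fun x hx => hle x (by simp [hx])); simpa using this
  have ht : t.sum ≤ t.length * M := by
    have := List.sum_le_card_nsmul t M (fun x hx => hle x (by simp [hx])); simpa using this
  simp only [List.sum_append, List.sum_cons, List.length_append, List.length_cons, zero_add]
  have e : (s.length + (t.length + 1)) * M = s.length * M + t.length * M + M := by ring
  rw [e]; omega

/-- SOURCE SHAPE, every `k′`, `d ≥ 5`: a source exponent vector (entries `≤ d-2`, `sum + d = length·(d-2)`) with a zero entry has all its
other entries `≥ 1` (a second zero would force `d ≤ 4`). -/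
theorem source_others_pos (d : ℕ) (hd : 5 ≤ d) (as bs : List ℕ)
    (hle : ∀ x ∈ as ++ 0 :: bs, x ≤ d - 2) (hsum : (as ++ 0 :: bs).sum + d = (as ++ 0 :: bs).length * (d - 2)) :
    ∀ x ∈ as ++ bs, 1 ≤ x := by
  by_contra hcon
  push Not at hcon
  obtain ⟨x, hx, hx0⟩ := hcon
  have hx0' : x = 0 := by omega
  subst hx0'
  have hle' : ∀ y ∈ as ++ bs, y ≤ d - 2 := fun y hy => hle y (by
    rcases List.mem_append.mp hy with h | h
    · exact List.mem_append_left _ h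
    · exact List.mem_append_right _ (List.mem_cons_of_mem _ h))
  have key := sum_le_of_zero_mem (d - 2) (as ++ bs) hle' hx
  simp only [List.sum_append, List.sum_cons, List.length_append, List.length_cons] at hsum key
  have e : (as.length + (bs.length + 1)) * (d - 2) = (as.length + bs.length) * (d - 2) + (d - 2) := by ring
  rw [e] at hsum
  omega

/-- TARGET SHAPE, every `k′ ≥ 3` (`d ≥ 5`): a target exponent vector (entries `≤ d-2`, `sum + 2 = length·(d-2)`, length `≥ 3`) has an
entry equal to `d-2`. -/
theorem target_has_top (d : ℕ) (hd : 5 ≤ d) (v : List ℕ) (hk : 3 ≤ v.length) (hle : ∀ x ∈ v, x ≤ d - 2)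
    (hsum : v.sum + 2 = v.length * (d - 2)) : d - 2 ∈ v := by
  by_contra hno
  have hle' : ∀ x ∈ v, x ≤ d - 3 := by
    intro x hx
    have h1 := hle x hx
    have h2 : x ≠ d - 2 := fun h => hno (h ▸ hx)
    omega
  have key : v.sum ≤ v.length * (d - 3) := by
    have := List.sum_le_card_nsmul v (d - 3) hle'; simpa using this
  have e : v.length * (d - 2) = v.length * (d - 3) + v.length := by
    have : d - 2 = (d - 3) + 1 := by omega
    rw [this, Nat.mul_add, Nat.mul_one]
  rw [e] at hsum; omega

/-- COVERAGE, every `k′ ≥ 3` and `d ≥ 5`: every target monomial `v` is the unit column `[v]` of a source monomial `m` (same length,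
entries `≤ d-2`, source degree). -/
theorem covered_all (d : ℕ) (hd : 5 ≤ d) (v : List ℕ) (hk : 3 ≤ v.length) (hle : ∀ x ∈ v, x ≤ d - 2)
    (hsum : v.sum + 2 = v.length * (d - 2)) :
    ∃ m : List ℕ, m.length = v.length ∧ (∀ x ∈ m, x ≤ d - 2) ∧ m.sum + d = m.length * (d - 2) ∧ colR d m = [v] := by
  obtain ⟨as, bs, rfl⟩ := List.append_of_mem (target_has_top d hd v hk hle hsum)
  refine ⟨as ++ 0 :: bs, by simp, ?_, ?_, ?_⟩
  · intro x hx
    simp only [List.mem_append, List.mem_cons] at hx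
    rcases hx with h | h | h
    · exact hle x (by simp [h])
    · omega
    · exact hle x (by simp [h])
  · simp only [List.sum_append, List.sum_cons, List.length_append, List.length_cons] at hsum ⊢
    omega
  · have hpos : ∀ x ∈ as ++ bs, 1 ≤ x := by
      by_contra hcon
      push Not at hcon
      obtain ⟨x, hx, hx0⟩ := hcon
      have hx0' : x = 0 := by omega
      subst hx0'
      have hle' : ∀ y ∈ as ++ bs, y ≤ d - 2 := fun y hy => hle y (by
        rcases List.mem_append.mp hy with h | h
        · exact List.mem_append_left _ h
        · exact List.mem_append_right _ (List.mem_cons_of_mem _ h))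
      have key := sum_le_of_zero_mem (d - 2) (as ++ bs) hle' hx
      simp only [List.sum_append, List.sum_cons, List.length_append, List.length_cons] at hsum key
      have e : (as.length + (bs.length + 1)) * (d - 2) = (as.length + bs.length) * (d - 2) + (d - 2) := by ring
      rw [e] at hsum
      omega
    exact colR_one_zero d as bs (fun x hx => hpos x (List.mem_append_left _ hx))
      (fun x hx => hpos x (List.mem_append_right _ hx))

/-- UNIT-OR-ZERO, every `k′`, `d ≥ 5`: every column of `×δ` on the source basis is a unit vector or zero. -/
theorem column_unit_or_zero (d : ℕ) (hd : 5 ≤ d) (m : List ℕ) (hle : ∀ x ∈ m, x ≤ d - 2)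
    (hsum : m.sum + d = m.length * (d - 2)) : colR d m = [] ∨ ∃ v, colR d m = [v] := by
  by_cases h0 : (0 : ℕ) ∈ m
  · obtain ⟨as, bs, rfl⟩ := List.append_of_mem h0
    have hpos := source_others_pos d hd as bs hle hsum
    exact Or.inr ⟨_, colR_one_zero d as bs (fun x hx => hpos x (List.mem_append_left _ hx))
      (fun x hx => hpos x (List.mem_append_right _ hx))⟩
  · left
    exact colR_pos d m (fun x hx => by
      have : x ≠ 0 := fun h => h0 (h ▸ hx)
      omega)

/-- small evaluations of `colR` -/
theorem colR_examples : colR 7 [0, 3, 5] = [[5, 3, 5]] ∧ colR 7 [1, 2, 5] = [] ∧ colR 5 [0, 0, 1] = [[3, 0, 1], [0, 3, 1]] := by decide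

/-- cross-check against the companion file: `colR = suppMulL` on every source monomial, `k′ = 2,3,4`, `d = 5..8` (`decide`). -/
theorem colR_eq_suppMulL_table :
    ∀ k ∈ [2, 3, 4], ∀ d ∈ List.range' 5 4, ∀ m ∈ basisL d k (sdeg d k), colR d m = suppMulL d m := by
  decide

end Summit.HodgeConjecture.HodgeConjecture.HodgeLocus.Census.ModelNonJumpC1All
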